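import Summits.BirchSwinnertonDyer.BirchSwinnertonDyer.Theses.TameQuarticManinParity
import Literature.NumberTheory.EllipticCurves.QuadraticTwist
import HarnessLib

/-!
# Route `TameQuarticManinParity`, LINE 25b (bsd-idea-3 g8), glue GT24L `TprimeIrrOptimalTwistNeronLatticeOfSplit`
# (stmt-BirchSwinnertonDyer-22824) — PROVED BY NAME: α (twist of optimal is optimal) ∧ β (Néron lattice of the ramified
# −3-twist at a type-III prime 3) ⟹ T24L `TprimeIrrOptimalTwistNeronLattice` (stmt-22694)

Cell `pub/bsd-wall`, D-0145 line `route-BirchSwinnertonDyer-TeichmullerTwistDescent`, seat `bsd-line-ttd-p1` g10,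
landing the planner-of-record's LINE 25b glue (proof = planner bsd-idea-3 g8's `ideas/l25/Sketch25b.lean`, re-checked
against the tree). BSD is NOT proved by this; Manin's conjecture is not proved by this; α
(`TprimeIrrOptimalTwistIsTwistOfOptimal`, 22822), β (`TwistNeronLatticeKodairaThree`, 22823) and T24L (22694) are
the hypotheses / conclusion of the glue and are not proved here.

## Proof

Instantiate β with `L := D.L`, `L' := D'.L` (fields `isNeronLattice`), `C := A` (α gives `∃ v, v • W ⊗ (−3) = A`) and
`s := g(χ)`, using `g(χ)² = −3` (`gaussSum_sq_eq_neg_three`: Mathlib `gaussSum_sq`, `DirichletCharacter.conductor_one`,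
`MulChar.ne_one_iff`). Design: theorems only; no definition, no named fact, no `sorry`; axioms `propext`,
`Classical.choice`, `Quot.sound`.
-/

set_option autoImplicit false
-- D-0017: single-problem summit, so `Summit.BirchSwinnertonDyer.BirchSwinnertonDyer.…` repeats a namespace BY DESIGN.
set_option linter.dupNamespace false

noncomputable section

namespace Summit.BirchSwinnertonDyer.BirchSwinnertonDyer.Theorems.TameQuarticManinParity

open Literature.NumberTheory.EllipticCurves.ModularForms WeierstrassCurve
  Summit.BirchSwinnertonDyer.BirchSwinnertonDyer.Theses.TameQuarticManinParity

/-- **The Gauss sum of the primitive quadratic character mod `3` squares to `−3`** (`g(χ)² = χ(−1)·3` and the unique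
primitive quadratic character mod `3` is odd). Planner bsd-idea-3 g8's lemma (Sketch25b), re-checked. [folklore] -/
theorem gaussSum_sq_eq_neg_three (χ : DirichletCharacter ℂ 3) (hχ : χ.IsQuadratic) (hprim : χ.IsPrimitive) :
    gaussSum χ (ZMod.stdAddChar (N := 3)) ^ 2 = -3 := by
  have hne : χ ≠ 1 := by
    intro h
    have h1 : χ.conductor = 3 := hprim
    rw [h, DirichletCharacter.conductor_one] at h1
    norm_num at h1
  rw [gaussSum_sq hne hχ (ZMod.isPrimitive_stdAddChar 3)]
  have hcard : (Fintype.card (ZMod 3) : ℂ) = 3 := by simp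
  rw [hcard]
  -- `χ(−1) = −1`: the only quadratic nontrivial character mod 3 is odd
  have hm1 : χ (-1) = -1 := by
    have hsq : χ (-1) * χ (-1) = 1 := by rw [← map_mul]; norm_num
    rcases hχ (-1) with h0 | h1 | h2
    · rw [h0, zero_mul] at hsq; exact absurd hsq zero_ne_one
    · exfalso
      obtain ⟨a, ha⟩ := MulChar.ne_one_iff.mp hne
      obtain ⟨b, hb⟩ : ∃ b : ZMod 3, b = (a : ZMod 3) := ⟨_, rfl⟩
      fin_cases b
      · have hu : IsUnit ((a : ZMod 3)) := a.isUnit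
        rw [← hb] at hu
        exact not_isUnit_zero hu
      · apply ha
        have : (a : ZMod 3) = 1 := by rw [← hb]; rfl
        rw [this, map_one]
      · apply ha
        have : (a : ZMod 3) = -1 := by rw [← hb]; simp only []; exact (by decide : (2 : ZMod 3) = -1)
        rw [this, h1]
    · exact h2
  rw [hm1]; norm_num


/-- **Glue GT24L `TprimeIrrOptimalTwistNeronLatticeOfSplit`** (stmt-BirchSwinnertonDyer-22824), by name: α ∧ β ⟹ T24L.
[cite: Stevens1989, Lemma (5.2)] -/
theorem tprimeIrrOptimalTwistNeronLatticeOfSplit_proof : TprimeIrrOptimalTwistNeronLatticeOfSplit := by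
  unfold TprimeIrrOptimalTwistNeronLatticeOfSplit
  intro hα hβ W _ _ _ hcm hadd ht hirr h3 D hex hmin h9 χ hχ hprim A _ _ D' hf hex' hmin' z
  obtain ⟨v, hv⟩ := hα W hcm hadd ht hirr h3 D hex hmin h9 χ hχ hprim A D' hf hex' hmin'
  exact hβ W D.L D.isNeronLattice hadd h3 A ⟨v, hv⟩ D'.L D'.isNeronLattice _
    (gaussSum_sq_eq_neg_three χ hχ hprim) z

end Summit.BirchSwinnertonDyer.BirchSwinnertonDyer.Theorems.TameQuarticManinParity

end
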